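import Mathlib
import Literature.Probability.LatticeModels.GKSInequalities
import HarnessLib
import Summits.CriticalPhenomena.Ising3DConformalLimit.Theorems.PrecisionLaplacianInverseMFerromagnetLevelThreeAux

/-!
# Crux `PrecisionLaplacian.InverseMFerromagnet` (stmt-CriticalPhenomena-4798), line `Sketch` —
# stub `stub_level_three`: level three of the partial-covariance ladder

THEOREM-ONLY file (no definitions).  `G = (⟨σ_pσ_q⟩)` is the spin second-moment matrix of a
zero-field pair ferromagnet (`gksExpect univ K C`, `K ≥ 0`, `|C i| = 2`, sites `Fin n`).  Level three:
for `S = {a,b,c} ∌ x, y`, `x ≠ y`,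
`PCov(x,y|S) = G x y − ∑_{p,q ∈ S} G x p ((G_SS)⁻¹)_{pq} G q y ≥ 0`, assuming the three neighbour
stubs (h₁) conditioning = freezing, (h₂) nonnegativity of the averaged conditional covariance,
(h₃) GHS with sign flips.

Mechanism.  With cylinder probabilities `P(s) = ⟨1_s⟩`, `a_x(s) = ⟨σ_x 1_s⟩` (`s : ↥S → ℤˣ`) and the
conditional magnetisation `m_x = a_x / P` (an odd function on the cube `{±1}³`, hence
`m_x = linear + κ_x s_a s_b s_c`), the abstract Schur-complement identity of the auxiliary file gives
`PCov = (G x y − ∑_s a_x a_y / P) + κ_x κ_y (1 − vᵀ (G_SS)⁻¹ v)`; the first term is `≥ 0` by (h₂), the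
bracket is a residual variance, and `κ_x, κ_y ≤ 0`: by (h₁) `m_x(s)` is the magnetisation of the
*frozen* system, which this file regroups (up to a constant in the Hamiltonian) into the base pair
system of the pairs missing `S` plus the field `s_a F_a + s_b F_b + s_c F_c`, so that
`4κ_x = m_x(+++) + m_x(+−−) − m_x(++−) − m_x(+−+) ≤ 0` is (h₃).
-/

namespace Summit.CriticalPhenomena.Ising3DConformalLimit.Cruxes.InverseMFerromagnet.PartialCovarianceLadder

open Literature.Probability.LatticeModels Finset Matrix

noncomputable section

/-! ## The frozen system as a base pair system plus fields -/

/-- Per-term trichotomy for a pair `C i` against the frozen set `S`: either `C i` misses `S`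
(untouched pair term), or meets it in exactly one site `q` (a field term `K_i s_q σ_z` at the other
end `z`), or lies inside `S` (a constant). [folklore] -/
theorem l3_frozen_term_eq {n m : ℕ} (K : Fin m → ℝ) (C : Fin m → Finset (Fin n))
    (hC : ∀ i, (C i).card = 2) (S : Finset (Fin n)) (s : ↥S → ℤˣ) (i : Fin m)
    (ω : SpinConfig (Fin n)) :
    K i * (∏ p : ↥S, (if p.1 ∈ C i then (((s p : ℤˣ) : ℤ) : ℝ) else 1)) * spinProduct (C i \ S) ω
      = (if Disjoint (C i) S then K i else 0) * spinProduct (C i) ω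
        + ∑ z : Fin n, (∑ q : ↥S,
            (if C i \ S = {z} ∧ C i ∩ S = {q.1} then K i * (((s q : ℤˣ) : ℤ) : ℝ) else 0))
              * spinProduct {z} ω
        + (if C i ⊆ S then K i * ∏ p : ↥S, (if p.1 ∈ C i then (((s p : ℤˣ) : ℤ) : ℝ) else 1)
            else 0) := by
  have hne : (C i).Nonempty := by
    rw [← Finset.card_pos, hC]
    norm_num
  by_cases hd : Disjoint (C i) S
  · have hsd : C i \ S = C i := Finset.sdiff_eq_self_of_disjoint hd
    have hns : ¬ C i ⊆ S := fun h => by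
      obtain ⟨z, hz⟩ := hne
      exact Finset.disjoint_left.mp hd hz (h hz)
    have hprod : ∏ p : ↥S, (if p.1 ∈ C i then (((s p : ℤˣ) : ℤ) : ℝ) else 1) = 1 :=
      Finset.prod_eq_one fun p _ => if_neg (Finset.disjoint_right.mp hd p.2)
    have hmid : ∀ z : Fin n, C i ≠ {z} := fun z h => by
      have h' := congrArg Finset.card h
      rw [hC, Finset.card_singleton] at h'
      exact absurd h' (by norm_num)
    rw [hprod, hsd]
    simp [hns, hmid, hd]
  · by_cases hsub : C i ⊆ S
    · have hsd : C i \ S = ∅ := Finset.sdiff_eq_empty_iff_subset.mpr hsub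
      simp [hsd, hsub, hd]
    · have hcard : (C i \ S).card + (C i ∩ S).card = 2 := by
        rw [Finset.card_sdiff_add_card_inter, hC]
      have h1 : 0 < (C i \ S).card := Finset.card_pos.mpr (Finset.sdiff_nonempty.mpr hsub)
      have h2 : 0 < (C i ∩ S).card :=
        Finset.card_pos.mpr (Finset.not_disjoint_iff_nonempty_inter.mp hd)
      obtain ⟨z₀, hz₀⟩ := Finset.card_eq_one.mp (by omega : (C i \ S).card = 1)
      obtain ⟨q₀, hq₀⟩ := Finset.card_eq_one.mp (by omega : (C i ∩ S).card = 1)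
      have hq₀' : q₀ ∈ C i ∩ S := by
        rw [hq₀]
        exact Finset.mem_singleton_self q₀
      have hq₀S : q₀ ∈ S := (Finset.mem_inter.mp hq₀').2
      have hiff : ∀ p : ↥S, (p.1 ∈ C i) ↔ p = ⟨q₀, hq₀S⟩ := fun p => by
        constructor
        · intro hp
          have hp' : p.1 ∈ C i ∩ S := Finset.mem_inter.mpr ⟨hp, p.2⟩
          rw [hq₀, Finset.mem_singleton] at hp'
          exact Subtype.ext hp'
        · rintro rfl
          exact (Finset.mem_inter.mp hq₀').1
      have hprod : ∏ p : ↥S, (if p.1 ∈ C i then (((s p : ℤˣ) : ℤ) : ℝ) else 1)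
          = (((s ⟨q₀, hq₀S⟩ : ℤˣ) : ℤ) : ℝ) := by
        simp_rw [hiff]
        rw [Finset.prod_ite_eq']
        simp
      have hiff2 : ∀ q : ↥S, (C i ∩ S = {q.1}) ↔ q = ⟨q₀, hq₀S⟩ := fun q => by
        rw [hq₀, Finset.singleton_inj]
        constructor
        · intro h
          exact Subtype.ext h.symm
        · rintro rfl
          rfl
      rw [hprod, hz₀]
      simp only [hd, hsub, if_false, zero_mul, zero_add, add_zero, Finset.singleton_inj, hiff2]
      rw [Finset.sum_eq_single z₀]
      · simp [Finset.sum_ite_eq']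
      · intro z _ hz
        simp [Ne.symm hz]
      · simp

/-- Freezing the spins on `S` in the pattern `s` gives, up to an additive constant in the Hamiltonian,
the base pair system `K⁰` (pairs missing `S`) plus the field `F^s(z) = ∑_{q ∈ S} s_q F_q(z)`,
`F_q(z) = ∑_{i : C_i = {z, q}} K_i`; hence the same Gibbs expectations. [folklore] -/
theorem l3_frozen_eq_field {n m : ℕ} (K : Fin m → ℝ) (C : Fin m → Finset (Fin n))
    (hC : ∀ i, (C i).card = 2) (S : Finset (Fin n)) (s : ↥S → ℤˣ) (f : SpinConfig (Fin n) → ℝ) :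
    gksExpect Finset.univ
        (fun i => K i * ∏ p : ↥S, (if p.1 ∈ C i then (((s p : ℤˣ) : ℤ) : ℝ) else 1))
        (fun i => C i \ S) f
      = gksExpect (Finset.univ : Finset (Fin m ⊕ Fin n))
          (Sum.elim (fun i => if Disjoint (C i) S then K i else 0)
            (fun z => ∑ q : ↥S, (((s q : ℤˣ) : ℤ) : ℝ)
              * ∑ i, (if C i \ S = {z} ∧ C i ∩ S = {q.1} then K i else 0)))
          (Sum.elim C (fun z => ({z} : Finset (Fin n)))) f := by
  apply l3_gksExpect_eq_of_hamiltonian_eq_add_const (c := ∑ i, if C i ⊆ S then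
    K i * ∏ p : ↥S, (if p.1 ∈ C i then (((s p : ℤˣ) : ℤ) : ℝ) else 1) else 0)
  intro ω
  simp only [gksHamiltonian, Fintype.sum_sum_type, Sum.elim_inl, Sum.elim_inr,
    l3_frozen_term_eq K C hC S s, Finset.sum_add_distrib]
  have hmid : ∑ i, ∑ z, (∑ q : ↥S,
        (if C i \ S = {z} ∧ C i ∩ S = {q.1} then K i * (((s q : ℤˣ) : ℤ) : ℝ) else 0))
          * spinProduct {z} ω
      = ∑ z, (∑ q : ↥S, (((s q : ℤˣ) : ℤ) : ℝ)
          * ∑ i, (if C i \ S = {z} ∧ C i ∩ S = {q.1} then K i else 0)) * spinProduct {z} ω := by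
    rw [Finset.sum_comm]
    refine Finset.sum_congr rfl fun z _ => ?_
    rw [← Finset.sum_mul]
    congr 1
    rw [Finset.sum_comm]
    refine Finset.sum_congr rfl fun q _ => ?_
    rw [Finset.mul_sum]
    refine Finset.sum_congr rfl fun i _ => ?_
    split_ifs <;> ring
  rw [hmid]

/-- Under (h₁) "conditioning = freezing", the conditional magnetisation `⟨σ_x 1_s⟩/⟨1_s⟩` at a site
`x ∉ S` equals the magnetisation at `x` of the base pair system `K⁰` in the field
`F^s = ∑_{q ∈ S} s_q F_q`. [folklore] -/
theorem l3_condMag_eq_field {n m : ℕ} (K : Fin m → ℝ) (C : Fin m → Finset (Fin n))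
    (hC : ∀ i, (C i).card = 2)
    (h₁ : ∀ (n m : ℕ) (K : Fin m → ℝ) (C : Fin m → Finset (Fin n)) (S T : Finset (Fin n)), Disjoint T S → ∀ s : ↥S → ℤˣ, gksExpect Finset.univ K C (fun ω => spinProduct T ω * ∏ p : ↥S, (1 + (((s p : ℤˣ) : ℤ) : ℝ) * spinAt p.1 ω) / 2) = gksExpect Finset.univ K C (fun ω => ∏ p : ↥S, (1 + (((s p : ℤˣ) : ℤ) : ℝ) * spinAt p.1 ω) / 2) * gksExpect Finset.univ (fun i => K i * ∏ p : ↥S, (if p.1 ∈ C i then (((s p : ℤˣ) : ℤ) : ℝ) else 1)) (fun i => C i \ S) (spinProduct T))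
    (S : Finset (Fin n)) (x : Fin n) (hx : x ∉ S) (s : ↥S → ℤˣ) :
    gksExpect Finset.univ K C
        (fun ω => spinAt x ω * ∏ p : ↥S, (1 + (((s p : ℤˣ) : ℤ) : ℝ) * spinAt p.1 ω) / 2)
      / gksExpect Finset.univ K C
        (fun ω => ∏ p : ↥S, (1 + (((s p : ℤˣ) : ℤ) : ℝ) * spinAt p.1 ω) / 2)
    = gksExpect (Finset.univ : Finset (Fin m ⊕ Fin n))
          (Sum.elim (fun i => if Disjoint (C i) S then K i else 0)
            (fun z => ∑ q : ↥S, (((s q : ℤˣ) : ℤ) : ℝ)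
              * ∑ i, (if C i \ S = {z} ∧ C i ∩ S = {q.1} then K i else 0)))
          (Sum.elim C (fun z => ({z} : Finset (Fin n)))) (spinAt x) := by
  have hsp : (spinProduct ({x} : Finset (Fin n)) : SpinConfig (Fin n) → ℝ) = spinAt x := by
    funext ω
    simp [spinProduct]
  have h := h₁ n m K C S {x} (Finset.disjoint_singleton_left.mpr hx) s
  rw [hsp] at h
  rw [h, mul_div_cancel_left₀ _ (l3_gksExpect_cyl_pos _ K C S s).ne']
  exact l3_frozen_eq_field K C hC S s (spinAt x)

/-- Level-three sign lemma (`κ_x ≤ 0`): for `S = {a, b, c}` and `x ∉ S`, the conditional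
magnetisations `m(s) = ⟨σ_x 1_s⟩/⟨1_s⟩` satisfy `m(+++) + m(+−−) ≤ m(++−) + m(+−+)`; by (h₁) these are
magnetisations of the base system in the fields `F_a ± F_b ± F_c`, and the inequality is (h₃) "GHS with
sign flips" with `B = F_a`, `A = F_b`, `Cf = F_c`. [folklore] -/
theorem l3_kappa_sign {n m : ℕ} (K : Fin m → ℝ) (C : Fin m → Finset (Fin n)) (hK : ∀ i, 0 ≤ K i)
    (hC : ∀ i, (C i).card = 2)
    (h₁ : ∀ (n m : ℕ) (K : Fin m → ℝ) (C : Fin m → Finset (Fin n)) (S T : Finset (Fin n)), Disjoint T S → ∀ s : ↥S → ℤˣ, gksExpect Finset.univ K C (fun ω => spinProduct T ω * ∏ p : ↥S, (1 + (((s p : ℤˣ) : ℤ) : ℝ) * spinAt p.1 ω) / 2) = gksExpect Finset.univ K C (fun ω => ∏ p : ↥S, (1 + (((s p : ℤˣ) : ℤ) : ℝ) * spinAt p.1 ω) / 2) * gksExpect Finset.univ (fun i => K i * ∏ p : ↥S, (if p.1 ∈ C i then (((s p : ℤˣ) : ℤ) : ℝ) else 1)) (fun i => C i \ S) (spinProduct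 T))
    (h₃ : ∀ (n m : ℕ) (K : Fin m → ℝ) (C : Fin m → Finset (Fin n)), (∀ i, 0 ≤ K i) → (∀ i, (C i).card ≤ 2) → ∀ (A B Cf : Fin n → ℝ), (∀ z, 0 ≤ A z) → (∀ z, 0 ≤ B z) → (∀ z, 0 ≤ Cf z) → ∀ x : Fin n, gksExpect (Finset.univ : Finset (Fin m ⊕ Fin n)) (Sum.elim K (B + A + Cf)) (Sum.elim C (fun z => ({z} : Finset (Fin n)))) (spinAt x) + gksExpect (Finset.univ : Finset (Fin m ⊕ Fin n)) (Sum.elim K (B - A - Cf)) (Sum.elim C (fun z => ({z} : Finset (Fin n)))) (spinAt x) ≤ gksExpect (Finset.univ : Finset (Fin m ⊕ Fin n)) (Sum.elim K (B + A - Cf)) (Sum.elim C (fun z => ({z} : Finset (Fin n)))) (spinAt x) + gksExpect (Finset.univ : Finset (Fin m ⊕ Fin n)) (Sum.elim K (B - A + Cf)) (Sum.elim C (fun z => ({z} : Finset (Fin n)))) (spinAt x))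
    {a b c : Fin n} (hab : a ≠ b) (hac : a ≠ c) (hbc : b ≠ c) (x : Fin n)
    (hx : x ∉ ({a, b, c} : Finset (Fin n)))
    (pat : ℤˣ → ℤˣ → ℤˣ → (↥({a, b, c} : Finset (Fin n)) → ℤˣ))
    (hpa : ∀ u v w, pat u v w ⟨a, by simp⟩ = u) (hpb : ∀ u v w, pat u v w ⟨b, by simp⟩ = v)
    (hpc : ∀ u v w, pat u v w ⟨c, by simp⟩ = w)
    (μ : (↥({a, b, c} : Finset (Fin n)) → ℤˣ) → ℝ)
    (hμ : ∀ s, μ s = gksExpect Finset.univ K C (fun ω => spinAt x ω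
        * ∏ p : ↥({a, b, c} : Finset (Fin n)), (1 + (((s p : ℤˣ) : ℤ) : ℝ) * spinAt p.1 ω) / 2)
      / gksExpect Finset.univ K C
        (fun ω => ∏ p : ↥({a, b, c} : Finset (Fin n)), (1 + (((s p : ℤˣ) : ℤ) : ℝ) * spinAt p.1 ω) / 2)) :
    μ (pat 1 1 1) + μ (pat 1 (-1) (-1)) ≤ μ (pat 1 1 (-1)) + μ (pat 1 (-1) 1) := by
  obtain ⟨Fq, hFq⟩ : ∃ Fq : ↥({a, b, c} : Finset (Fin n)) → Fin n → ℝ, ∀ q z, Fq q z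
      = ∑ i, (if C i \ {a, b, c} = {z} ∧ C i ∩ {a, b, c} = {q.1} then K i else 0) :=
    ⟨_, fun _ _ => rfl⟩
  have hFnn : ∀ q z, 0 ≤ Fq q z := fun q z => by
    rw [hFq]
    exact Finset.sum_nonneg fun i _ => by split_ifs <;> [exact hK i; exact le_rfl]
  have hmag : ∀ v w : ℤˣ, μ (pat 1 v w) = gksExpect (Finset.univ : Finset (Fin m ⊕ Fin n))
      (Sum.elim (fun i => if Disjoint (C i) {a, b, c} then K i else 0)
        (Fq ⟨a, by simp⟩ + (((v : ℤˣ) : ℤ) : ℝ) • Fq ⟨b, by simp⟩ + (((w : ℤˣ) : ℤ) : ℝ) • Fq ⟨c, by simp⟩))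
      (Sum.elim C (fun z => ({z} : Finset (Fin n)))) (spinAt x) := by
    intro v w
    rw [hμ, l3_condMag_eq_field K C hC h₁ {a, b, c} x hx (pat 1 v w)]
    congr 2
    funext z
    simp only [Pi.add_apply, Pi.smul_apply, smul_eq_mul, hFq]
    rw [l3_sum_subtype_three hab hac hbc]
    simp only [hpa, hpb, hpc, Units.val_one, Int.cast_one, one_mul]
  rw [hmag, hmag, hmag, hmag]
  simp only [Units.val_one, Units.val_neg, Int.cast_one, Int.cast_neg, one_smul, neg_one_smul,
    ← sub_eq_add_neg]
  set K0 : Fin m → ℝ := fun i => if Disjoint (C i) {a, b, c} then K i else 0 with hK0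
  have hK0nn : ∀ i, 0 ≤ K0 i := fun i => by
    simp only [hK0]
    split_ifs <;> [exact hK i; exact le_rfl]
  exact h₃ n m K0 C hK0nn (fun i => (hC i).le) (Fq ⟨b, by simp⟩) (Fq ⟨a, by simp⟩) (Fq ⟨c, by simp⟩)
    (hFnn _) (hFnn _) (hFnn _) x

/-! ## Moment identities -/

/-- `⟨σ_p σ_q⟩ = ∑_s ⟨1_s⟩ s_p s_q` for `p, q ∈ S`. [folklore] -/
theorem l3_moment_SS {n m : ℕ} (K : Fin m → ℝ) (C : Fin m → Finset (Fin n)) (S : Finset (Fin n))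
    (p q : ↥S) :
    gksExpect Finset.univ K C (fun ω => spinAt p.1 ω * spinAt q.1 ω)
      = ∑ s : ↥S → ℤˣ, gksExpect Finset.univ K C
          (fun ω => ∏ r : ↥S, (1 + (((s r : ℤˣ) : ℤ) : ℝ) * spinAt r.1 ω) / 2)
          * (((s p : ℤˣ) : ℤ) : ℝ) * (((s q : ℤˣ) : ℤ) : ℝ) := by
  have h := l3_gksExpect_mul_restrict Finset.univ K C S (fun _ => (1 : ℝ))
    (fun s => (((s p : ℤˣ) : ℤ) : ℝ) * (((s q : ℤˣ) : ℤ) : ℝ))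
  simp only [one_mul] at h
  rw [show (fun ω => spinAt p.1 ω * spinAt q.1 ω)
      = fun ω : SpinConfig (Fin n) => (((ω p.1 : ℤˣ) : ℤ) : ℝ) * (((ω q.1 : ℤˣ) : ℤ) : ℝ) from rfl, h]
  exact Finset.sum_congr rfl fun s _ => by ring

/-- `⟨σ_x σ_p⟩ = ∑_s ⟨σ_x 1_s⟩ s_p` for `p ∈ S`. [folklore] -/
theorem l3_moment_xS {n m : ℕ} (K : Fin m → ℝ) (C : Fin m → Finset (Fin n)) (S : Finset (Fin n))
    (x : Fin n) (p : ↥S) :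
    gksExpect Finset.univ K C (fun ω => spinAt x ω * spinAt p.1 ω)
      = ∑ s : ↥S → ℤˣ, gksExpect Finset.univ K C
          (fun ω => spinAt x ω * ∏ r : ↥S, (1 + (((s r : ℤˣ) : ℤ) : ℝ) * spinAt r.1 ω) / 2)
          * (((s p : ℤˣ) : ℤ) : ℝ) :=
  l3_gksExpect_mul_restrict Finset.univ K C S (spinAt x) (fun s => (((s p : ℤˣ) : ℤ) : ℝ))

/-! ## Level three -/

/-- Registered stub `stub_level_three` (level three of the partial-covariance ladder): given
(h₁) conditioning = freezing, (h₂) nonnegativity of the averaged conditional covariance and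
(h₃) GHS with sign flips, `PCov(x,y | {a,b,c}) ≥ 0`.  Proof: Walsh decomposition
`⟨σ_x | σ_S⟩ = linear + κ_x σ_aσ_bσ_c`, the identity
`PCov = (Σ_xy − ∑_s a_x a_y / P) + κ_xκ_y (1 − vᵀ(Σ_SS)⁻¹v)` and `κ_x, κ_y ≤ 0`. [folklore] -/
theorem stub_level_three : (∀ (n m : ℕ) (K : Fin m → ℝ) (C : Fin m → Finset (Fin n)) (S T : Finset (Fin n)), Disjoint T S → ∀ s : ↥S → ℤˣ, gksExpect Finset.univ K C (fun ω => spinProduct T ω * ∏ p : ↥S, (1 + (((s p : ℤˣ) : ℤ) : ℝ) * spinAt p.1 ω) / 2) = gksExpect Finset.univ K C (fun ω => ∏ p : ↥S, (1 + (((s p : ℤˣ) : ℤ) : ℝ) * spinAt p.1 ω) / 2) * gksExpect Finset.univ (fun i => K i * ∏ p : ↥S, (if p.1 ∈ C i then (((s p : ℤˣ) : ℤ) : ℝ) else 1)) (fun i => C i \ S) (spinProduct T)) → (∀ (n m : ℕ) (K : Fin m → ℝ) (C : Fin m → Finset (Fin n)), (∀ i, 0 ≤ K i) → (∀ i, (C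 i).card = 2) → ∀ (x y : Fin n) (S : Finset (Fin n)), x ∉ S → y ∉ S → ∑ s : (↥S → ℤˣ), gksExpect Finset.univ K C (fun ω => spinAt x ω * ∏ p : ↥S, (1 + (((s p : ℤˣ) : ℤ) : ℝ) * spinAt p.1 ω) / 2) * gksExpect Finset.univ K C (fun ω => spinAt y ω * ∏ p : ↥S, (1 + (((s p : ℤˣ) : ℤ) : ℝ) * spinAt p.1 ω) / 2) / gksExpect Finset.univ K C (fun ω => ∏ p : ↥S, (1 + (((s p : ℤˣ) : ℤ) : ℝ) * spinAt p.1 ω) / 2) ≤ gksExpect Finset.univ K C (fun ω => spinAt x ω * spinAt y ω)) → (∀ (n m : ℕ) (K : Fin m → ℝ) (C : Fin m → Finset (Fin n)), (∀ i, 0 ≤ K i) → (∀ i, (C i).card ≤ 2) → ∀ (A B Cf : Fin n → ℝ), (∀ z, 0 ≤ A z) → (∀ z, 0 ≤ B z) → (∀ z, 0 ≤ Cf z) → ∀ x : Fin n, gksExpect (Finset.univ : Finset (Fin m ⊕ Fin n)) (Sum.elim K (B + A + Cf)) (Sum.elim C (fun z => ({z} : Finset (Fin n)))) (spinAt x) +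 gksExpect (Finset.univ : Finset (Fin m ⊕ Fin n)) (Sum.elim K (B - A - Cf)) (Sum.elim C (fun z => ({z} : Finset (Fin n)))) (spinAt x) ≤ gksExpect (Finset.univ : Finset (Fin m ⊕ Fin n)) (Sum.elim K (B + A - Cf)) (Sum.elim C (fun z => ({z} : Finset (Fin n)))) (spinAt x) + gksExpect (Finset.univ : Finset (Fin m ⊕ Fin n)) (Sum.elim K (B - A + Cf)) (Sum.elim C (fun z => ({z} : Finset (Fin n)))) (spinAt x)) → ∀ (n m : ℕ) (K : Fin m → ℝ) (C : Fin m → Finset (Fin n)), (∀ i, 0 ≤ K i) → (∀ i, (C i).card = 2) → ∀ G : Matrix (Fin n) (Fin n) ℝ, G = Matrix.of (fun p q : Fin n => gksExpect Finset.univ K C (fun ω => spinAt p ω * spinAt q ω)) → ∀ (x y : Fin n) (S : Finset (Fin n)), x ≠ y → x ∉ S → y ∉ S → S.card = 3 → 0 ≤ G x y - ∑ p : ↥S, ∑ q : ↥S, G x p.1 * (G.submatrix (Subtype.val : ↥S → Fin n) (Subtype.val : ↥S → Fin n))⁻¹ p q * G q.1 y := by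
  intro h₁ h₂ h₃ n m K C hK hC G hG x y S hxy hx hy hS3
  obtain ⟨a, b, c, hab, hac, hbc, rfl⟩ := Finset.card_eq_three.1 hS3
  by_cases hdet : IsUnit (G.submatrix (Subtype.val : ↥({a, b, c} : Finset (Fin n)) → Fin n)
      (Subtype.val : ↥({a, b, c} : Finset (Fin n)) → Fin n)).det
  swap
  · rw [Matrix.nonsing_inv_apply_not_isUnit _ hdet]
    simp only [Matrix.zero_apply, mul_zero, zero_mul, Finset.sum_const_zero, sub_zero]
    rw [hG, Matrix.of_apply]
    have hfun : (fun ω => spinAt x ω * spinAt y ω) = spinProduct ({x, y} : Finset (Fin n)) := by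
      funext ω
      simp [spinProduct, Finset.prod_pair hxy]
    rw [hfun]
    exact gksExpect_spinProduct_nonneg _ _ _ (fun i _ => hK i) _
  -- notation: cylinder probabilities `P`, `a_x`, `a_y`, conditional magnetisations `mx`, `my`
  obtain ⟨P, hP⟩ : ∃ P : (↥({a, b, c} : Finset (Fin n)) → ℤˣ) → ℝ, ∀ s, P s
      = gksExpect Finset.univ K C (fun ω => ∏ p : ↥({a, b, c} : Finset (Fin n)),
          (1 + (((s p : ℤˣ) : ℤ) : ℝ) * spinAt p.1 ω) / 2) := ⟨_, fun _ => rfl⟩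
  obtain ⟨ax, hax⟩ : ∃ ax : (↥({a, b, c} : Finset (Fin n)) → ℤˣ) → ℝ, ∀ s, ax s
      = gksExpect Finset.univ K C (fun ω => spinAt x ω * ∏ p : ↥({a, b, c} : Finset (Fin n)),
          (1 + (((s p : ℤˣ) : ℤ) : ℝ) * spinAt p.1 ω) / 2) := ⟨_, fun _ => rfl⟩
  obtain ⟨ay, hay⟩ : ∃ ay : (↥({a, b, c} : Finset (Fin n)) → ℤˣ) → ℝ, ∀ s, ay s
      = gksExpect Finset.univ K C (fun ω => spinAt y ω * ∏ p : ↥({a, b, c} : Finset (Fin n)),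
          (1 + (((s p : ℤˣ) : ℤ) : ℝ) * spinAt p.1 ω) / 2) := ⟨_, fun _ => rfl⟩
  obtain ⟨mx, hmx⟩ : ∃ mx : (↥({a, b, c} : Finset (Fin n)) → ℤˣ) → ℝ, ∀ s, mx s = ax s / P s :=
    ⟨_, fun _ => rfl⟩
  obtain ⟨my, hmy⟩ : ∃ my : (↥({a, b, c} : Finset (Fin n)) → ℤˣ) → ℝ, ∀ s, my s = ay s / P s :=
    ⟨_, fun _ => rfl⟩
  have hPpos : ∀ s, 0 < P s := fun s => by
    rw [hP]
    exact l3_gksExpect_cyl_pos _ _ _ _ _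
  have hPmx : ∀ s, P s * mx s = ax s := fun s => by
    rw [hmx, mul_div_cancel₀ _ (hPpos s).ne']
  have hPmy : ∀ s, P s * my s = ay s := fun s => by
    rw [hmy, mul_div_cancel₀ _ (hPpos s).ne']
  -- moment identities
  have hMentry : ∀ p q : ↥({a, b, c} : Finset (Fin n)),
      G.submatrix (Subtype.val : ↥({a, b, c} : Finset (Fin n)) → Fin n)
        (Subtype.val : ↥({a, b, c} : Finset (Fin n)) → Fin n) p q
      = ∑ s, P s * (((s p : ℤˣ) : ℤ) : ℝ) * (((s q : ℤˣ) : ℤ) : ℝ) := by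
    intro p q
    simp only [Matrix.submatrix_apply, hG, Matrix.of_apply, hP]
    exact l3_moment_SS K C {a, b, c} p q
  have hGx : ∀ p : ↥({a, b, c} : Finset (Fin n)),
      G x p.1 = ∑ s, P s * mx s * (((s p : ℤˣ) : ℤ) : ℝ) := by
    intro p
    simp only [hPmx, hG, Matrix.of_apply, hax]
    exact l3_moment_xS K C {a, b, c} x p
  have hGy : ∀ q : ↥({a, b, c} : Finset (Fin n)),
      G q.1 y = ∑ s, P s * my s * (((s q : ℤˣ) : ℤ) : ℝ) := by
    intro q
    simp only [hPmy, hG, Matrix.of_apply, hay]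
    rw [show (fun ω => spinAt q.1 ω * spinAt y ω) = (fun ω => spinAt y ω * spinAt q.1 ω) from
      funext fun ω => mul_comm _ _]
    exact l3_moment_xS K C {a, b, c} y q
  -- oddness of the conditional magnetisations
  have hoddx : ∀ s, mx (-s) = -mx s := fun s => by
    rw [hmx, hmx, hax, hax, hP, hP, l3_gksExpect_spin_cyl_neg _ _ _ hC,
      l3_gksExpect_cyl_neg _ _ _ hC, neg_div]
  have hoddy : ∀ s, my (-s) = -my s := fun s => by
    rw [hmy, hmy, hay, hay, hP, hP, l3_gksExpect_spin_cyl_neg _ _ _ hC,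
      l3_gksExpect_cyl_neg _ _ _ hC, neg_div]
  -- sign patterns on the cube
  obtain ⟨pat, hpat⟩ : ∃ pat : ℤˣ → ℤˣ → ℤˣ → (↥({a, b, c} : Finset (Fin n)) → ℤˣ), ∀ u v w,
      pat u v w = fun p => if p.1 = a then u else if p.1 = b then v else w :=
    ⟨_, fun _ _ _ => rfl⟩
  have hpa : ∀ u v w, pat u v w ⟨a, by simp⟩ = u := fun u v w => by simp [hpat]
  have hpb : ∀ u v w, pat u v w ⟨b, by simp⟩ = v := fun u v w => by simp [hpat, hab.symm]
  have hpc : ∀ u v w, pat u v w ⟨c, by simp⟩ = w := fun u v w => by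
    simp [hpat, hac.symm, hbc.symm]
  have hext : ∀ s t : ↥({a, b, c} : Finset (Fin n)) → ℤˣ, s ⟨a, by simp⟩ = t ⟨a, by simp⟩ →
      s ⟨b, by simp⟩ = t ⟨b, by simp⟩ → s ⟨c, by simp⟩ = t ⟨c, by simp⟩ → s = t :=
    fun s t h1 h2 h3 => l3_subtype_three_ext s t h1 h2 h3
  -- Walsh decompositions `m = linear + κ · s_a s_b s_c`
  obtain ⟨lxa, lxb, lxc, hdx⟩ :=
    l3_odd_cube_decomp (⟨a, by simp⟩ : ↥({a, b, c} : Finset (Fin n))) ⟨b, by simp⟩ ⟨c, by simp⟩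
      pat hpa hpb hpc hext mx hoddx
  obtain ⟨lya, lyb, lyc, hdy⟩ :=
    l3_odd_cube_decomp (⟨a, by simp⟩ : ↥({a, b, c} : Finset (Fin n))) ⟨b, by simp⟩ ⟨c, by simp⟩
      pat hpa hpb hpc hext my hoddy
  -- signs `κ_x ≤ 0`, `κ_y ≤ 0`
  have hkx : (mx (pat 1 1 1) + mx (pat 1 (-1) (-1)) - mx (pat 1 1 (-1)) - mx (pat 1 (-1) 1)) / 4
      ≤ 0 := by
    have h := l3_kappa_sign K C hK hC h₁ h₃ hab hac hbc x hx pat hpa hpb hpc mx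
      (fun s => by rw [hmx, hax, hP])
    linarith
  have hky : (my (pat 1 1 1) + my (pat 1 (-1) (-1)) - my (pat 1 1 (-1)) - my (pat 1 (-1) 1)) / 4
      ≤ 0 := by
    have h := l3_kappa_sign K C hK hC h₁ h₃ hab hac hbc y hy pat hpa hpb hpc my
      (fun s => by rw [hmy, hay, hP])
    linarith
  -- the abstract Schur-complement inequality
  have hlin : ∀ (la lb lc : ℝ) (s : ↥({a, b, c} : Finset (Fin n)) → ℤˣ),
      ∑ p : ↥({a, b, c} : Finset (Fin n)),
        (fun p : ↥({a, b, c} : Finset (Fin n)) =>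
          if p.1 = a then la else if p.1 = b then lb else lc) p * (((s p : ℤˣ) : ℤ) : ℝ)
      = la * (((s ⟨a, by simp⟩ : ℤˣ) : ℤ) : ℝ) + lb * (((s ⟨b, by simp⟩ : ℤˣ) : ℤ) : ℝ)
        + lc * (((s ⟨c, by simp⟩ : ℤˣ) : ℤ) : ℝ) := by
    intro la lb lc s
    rw [l3_sum_subtype_three hab hac hbc]
    simp [hab.symm, hac.symm, hbc.symm]
  have key := l3_gram_schur_nonneg P (fun s => (hPpos s).le)
    (fun (p : ↥({a, b, c} : Finset (Fin n))) (s : ↥({a, b, c} : Finset (Fin n)) → ℤˣ) =>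
      (((s p : ℤˣ) : ℤ) : ℝ))
    (fun s => (((s ⟨a, by simp⟩ : ℤˣ) : ℤ) : ℝ) * (((s ⟨b, by simp⟩ : ℤˣ) : ℤ) : ℝ)
      * (((s ⟨c, by simp⟩ : ℤˣ) : ℤ) : ℝ))
    mx my _ hMentry hdet
    (fun p => if p.1 = a then lxa else if p.1 = b then lxb else lxc)
    (fun p => if p.1 = a then lya else if p.1 = b then lyb else lyc)
    _ _ (fun s => by rw [hlin]; exact hdx s) (fun s => by rw [hlin]; exact hdy s)
    (mul_nonneg_of_nonpos_of_nonpos hkx hky)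
  -- (h₂): `∑_s a_x a_y / P ≤ Σ_xy`
  have h2 := h₂ n m K C hK hC x y {a, b, c} hx hy
  simp only [← hax, ← hay, ← hP] at h2
  have hsum : ∑ s, P s * mx s * my s = ∑ s, ax s * ay s / P s := by
    refine Finset.sum_congr rfl fun s _ => ?_
    rw [hmx, hmy]
    field_simp
  have hGxy : G x y = gksExpect Finset.univ K C (fun ω => spinAt x ω * spinAt y ω) := by
    rw [hG, Matrix.of_apply]
  -- assemble
  have hds : ∑ p : ↥({a, b, c} : Finset (Fin n)), ∑ q : ↥({a, b, c} : Finset (Fin n)),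
      G x p.1 * (G.submatrix (Subtype.val : ↥({a, b, c} : Finset (Fin n)) → Fin n)
        (Subtype.val : ↥({a, b, c} : Finset (Fin n)) → Fin n))⁻¹ p q * G q.1 y
      = ∑ p : ↥({a, b, c} : Finset (Fin n)), ∑ q : ↥({a, b, c} : Finset (Fin n)),
        (∑ s, P s * mx s * (((s p : ℤˣ) : ℤ) : ℝ))
          * (G.submatrix (Subtype.val : ↥({a, b, c} : Finset (Fin n)) → Fin n)
            (Subtype.val : ↥({a, b, c} : Finset (Fin n)) → Fin n))⁻¹ p q
          * (∑ s, P s * my s * (((s q : ℤˣ) : ℤ) : ℝ)) := by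
    refine Finset.sum_congr rfl fun p _ => Finset.sum_congr rfl fun q _ => ?_
    rw [hGx, hGy]
  rw [hds]
  linarith [key, h2, hsum, hGxy]

end

end Summit.CriticalPhenomena.Ising3DConformalLimit.Cruxes.InverseMFerromagnet.PartialCovarianceLadder
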